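import Mathlib.Analysis.SpecificLimits.Basic
import Literature.Analysis.FluidPDE.ConfinedHardSphereFlowScattering
import Literature.Analysis.FluidPDE.HardSphereAlexander
import HarnessLib

/-!
# Existence of the confined hard-sphere flow on the torus among round scatterers: null bad set and Liouville

Last layer of the proof of `ConfinedHardSphereFlow.nonempty_torus_balls` (Cercignani–Illner–Pulvirenti
1994 Thm. 4.2.1 with App. 4.A p. 111, "The cases of reflecting boundary conditions […] can be
treated similarly"; Alexander 1975): for the event-by-event confined flow `ConfinedAlexander.flow`
of `N` spheres of diameter `ε` on the flat torus among the separated round scatterers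
`Wall.balls (Torus.geometry d) ctr ρ hρ` (`0 < ε < 1/2`, `0 < ρ < 1/2`,
`2ρ < dist(c_k, c_l)` for `k ≠ l`),

* `volume_confinedDomain_diff_good_eq_zero` — the complement of the good set `Γ₀` in the
  confined domain is Lebesgue-null (CIP 1994 Thm. 4.2.1 (1)–(3));
* `volume_good_inter_preimage_flow_eq` — each `T^t` preserves `vol|_{Γ₀}` (Liouville);
* `exists_confinedHardSphereFlow` — the hypothesis structure `ConfinedHardSphereFlow` is
  inhabited.

The proof is the window iteration of `Literature.Analysis.FluidPDE.HardSphereAlexander`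
(Gallagher–Saint-Raymond–Texier 2013, proof of Prop. 4.1.1), line by line, fed with the confined
short-time analysis (`ConfinedHardSphereFlowShortTime`, `…ShortBad`, `…Scattering`): with
`δ = t/(m+1)` the data that fail to be forward regular up to `t` have volume
`≤ (m+1) C δ² → 0`, and the one-window volume estimate plus invariance of the finite-volume
sets `Γ₀ ∩ {E ≤ V²/2}` give measure preservation.

## References

* C. Cercignani, R. Illner, M. Pulvirenti, *The Mathematical Theory of Dilute Gases*, Springer
  (1994), §4.2 (Thm. 4.2.1), App. 4.A pp. 107–111.
* R. K. Alexander, *The infinite hard sphere system*, Ph.D. thesis, UC Berkeley (1975).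
* I. Gallagher, L. Saint-Raymond, B. Texier, *From Newton to Boltzmann* (2013), Prop. 4.1.1.
-/

open Set Filter Function MeasureTheory Metric
open scoped ENNReal Topology InnerProductSpace

namespace Literature.Analysis.FluidPDE

noncomputable section

section Kinetic

namespace ConfinedAlexander

/-! ## Energy along the event-by-event confined flow -/

section Energy

variable {d : Type*} [Fintype d] {X : Type*} {N : ℕ} {ι : Type*} {G : Geometry d X} {W : ι → Wall d X} {ε : ℝ}

/-- The resolution of an event conserves the kinetic energy. [folklore] -/
theorem configEnergy_eventJump (z : Config N d X) : configEnergy (eventJump G W ε z) = configEnergy z := by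
  by_cases h : (Alexander.incomingPairs G ε z).Nonempty
  · rw [eventJump_of_incomingPairs_nonempty h, configEnergy_collidePair (ne_of_lt (Alexander.mem_incomingPairs.1 h.some_mem).1)]
  by_cases h' : (incomingWalls W z).Nonempty
  · rw [eventJump_of_incomingWalls_nonempty h h', configEnergy_reflectWall]
  · rw [eventJump_of_not_nonempty h h']

/-- The event step conserves the kinetic energy. [folklore] -/
theorem configEnergy_eventStep (z : Config N d X) : configEnergy (eventStep G W ε z) = configEnergy z := by
  by_cases h : exitTime G W ε z = ∞
  · rw [eventStep_of_eq_top h]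
  · rw [eventStep_of_ne_top h, configEnergy_eventJump, configEnergy_freeFlight]

/-- The post-event states have the kinetic energy of the datum. [folklore] -/
theorem configEnergy_stateAfter (z : Config N d X) (k : ℕ) : configEnergy (stateAfter G W ε z k) = configEnergy z := by
  induction k with
  | zero => rfl
  | succ k ih => rw [stateAfter_succ, configEnergy_eventStep, ih]

/-- The forward confined flow conserves the kinetic energy. [folklore] -/
theorem configEnergy_fwdFlow (z : Config N d X) (t : ℝ) : configEnergy (fwdFlow G W ε z t) = configEnergy z := by
  rw [fwdFlow, configEnergy_freeFlight, configEnergy_stateAfter]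

/-- The left-continuous forward confined flow conserves the kinetic energy. [folklore] -/
theorem configEnergy_fwdFlowLeft (z : Config N d X) (t : ℝ) : configEnergy (fwdFlowLeft G W ε z t) = configEnergy z := by
  rw [fwdFlowLeft, configEnergy_freeFlight, configEnergy_stateAfter]

/-- **Conservation of energy** for the event-by-event confined flow. [cite: CIP1994, §4.2 p. 65] -/
theorem configEnergy_flow (t : ℝ) (z : Config N d X) : configEnergy (flow G W ε t z) = configEnergy z := by
  unfold flow
  split_ifs
  · exact configEnergy_fwdFlow z t
  · rw [configEnergy_flipVel, configEnergy_fwdFlowLeft, configEnergy_flipVel]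

end Energy

variable {d : Type*} [Fintype d] {N : ℕ} {ι : Type*} [Finite ι] {ctr : ι → UnitAddTorus d} {ρ : ℝ} (hρ : 0 < ρ)

/-! ## Iterating the short-time analysis -/

section Iteration

variable {ε δ V : ℝ}

omit [Finite ι] in
/-- `iterGood` decreases with the number of iterations. [folklore] -/
theorem iterGood_succ_subset (m : ℕ) : iterGood (d := d) N ctr ρ (Wall.balls (Torus.geometry d) ctr ρ hρ) ε δ V (m + 1) ⊆ iterGood N ctr ρ (Wall.balls (Torus.geometry d) ctr ρ hρ) ε δ V m :=
  fun _ hz => ⟨hz.1, hz.2.1, fun k hk => hz.2.2 k (Nat.lt_succ_of_lt hk)⟩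

/-- **Regularity of the survivors**: a datum of `iterGood m` is forward regular up to time `(m+1)δ`. [cite: GST2013, proof of Prop. 4.1.1 p. 19] -/
theorem fwdGoodUpTo_of_mem_iterGood (hε : 0 < ε) (hch : ε + 2 * (2 * V * δ) < 2⁻¹) (hchρ : ρ + 2 * (2 * V * δ) < 2⁻¹)
    (hV0 : 0 ≤ V) (hδ : 0 ≤ δ) (m : ℕ) {z : Config N d (UnitAddTorus d)} (hz : z ∈ iterGood N ctr ρ (Wall.balls (Torus.geometry d) ctr ρ hρ) ε δ V m) :
    FwdGoodUpTo (Torus.geometry d) (Wall.balls (Torus.geometry d) ctr ρ hρ) ε (((m : ℝ) + 1) * δ) z := by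
  set W := Wall.balls (Torus.geometry d) ctr ρ hρ
  induction m generalizing z with
  | zero =>
    simp only [Nat.cast_zero, zero_add, one_mul]
    exact fwdGoodUpTo_of_mem_cShortGood hρ hε hch hchρ le_rfl hV0 hδ hz.1 hz.2.1
  | succ m ih =>
    have hreg := ih (iterGood_succ_subset hρ m hz)
    have hm0 : 0 ≤ ((m : ℝ) + 1) * δ := by positivity
    have hy : fwdFlow (Torus.geometry d) W ε z (((m : ℝ) + 1) * δ) ∈ cShortGood N ctr ε ρ (2 * V * δ) δ :=
      hz.2.2 m (Nat.lt_succ_self m)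
    have hEy : configEnergy (fwdFlow (Torus.geometry d) W ε z (((m : ℝ) + 1) * δ)) ≤ V ^ 2 / 2 := by
      rw [configEnergy_fwdFlow]; exact hz.1
    have hstep := hreg.add hm0 hδ (fwdGoodUpTo_of_mem_cShortGood hρ hε hch hchρ le_rfl hV0 hδ hEy hy)
    have hcast : (((m + 1 : ℕ) : ℝ) + 1) * δ = ((m : ℝ) + 1) * δ + δ := by push_cast; ring
    rw [hcast]
    exact hstep.1

/-- **Restart of the survivors.** [folklore] -/
theorem fwdFlow_add_of_mem_iterGood (hε : 0 < ε) (hch : ε + 2 * (2 * V * δ) < 2⁻¹) (hchρ : ρ + 2 * (2 * V * δ) < 2⁻¹)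
    (hV0 : 0 ≤ V) (hδ : 0 ≤ δ) (m : ℕ) {z : Config N d (UnitAddTorus d)} (hz : z ∈ iterGood N ctr ρ (Wall.balls (Torus.geometry d) ctr ρ hρ) ε δ V (m + 1)) :
    fwdFlow (Torus.geometry d) (Wall.balls (Torus.geometry d) ctr ρ hρ) ε z (((m : ℝ) + 1) * δ + δ) =
      fwdFlow (Torus.geometry d) (Wall.balls (Torus.geometry d) ctr ρ hρ) ε
        (fwdFlow (Torus.geometry d) (Wall.balls (Torus.geometry d) ctr ρ hρ) ε z (((m : ℝ) + 1) * δ)) δ := by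
  set W := Wall.balls (Torus.geometry d) ctr ρ hρ
  have hreg := fwdGoodUpTo_of_mem_iterGood hρ hε hch hchρ hV0 hδ m (iterGood_succ_subset hρ m hz)
  have hm0 : 0 ≤ ((m : ℝ) + 1) * δ := by positivity
  have hy : fwdFlow (Torus.geometry d) W ε z (((m : ℝ) + 1) * δ) ∈ cShortGood N ctr ε ρ (2 * V * δ) δ :=
    hz.2.2 m (Nat.lt_succ_self m)
  have hEy : configEnergy (fwdFlow (Torus.geometry d) W ε z (((m : ℝ) + 1) * δ)) ≤ V ^ 2 / 2 := by
    rw [configEnergy_fwdFlow]; exact hz.1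
  exact (hreg.add hm0 hδ (fwdGoodUpTo_of_mem_cShortGood hρ hε hch hchρ le_rfl hV0 hδ hEy hy)).2

/-- **The survivors do not lose volume under the confined flow.** [cite: GST2013, proof of Prop. 4.1.1 p. 19] -/
theorem volume_iterGood_inter_preimage_le (hε : 0 < ε) (hch : ε + 2 * (2 * V * δ) < 2⁻¹) (hchρ : ρ + 2 * (2 * V * δ) < 2⁻¹)
    (hV0 : 0 ≤ V) (hδ : 0 ≤ δ) (m : ℕ) {B : Set (Config N d (UnitAddTorus d))} (hB : MeasurableSet B) :
    volume {z | z ∈ iterGood N ctr ρ (Wall.balls (Torus.geometry d) ctr ρ hρ) ε δ V m ∧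
      fwdFlow (Torus.geometry d) (Wall.balls (Torus.geometry d) ctr ρ hρ) ε z (((m : ℝ) + 1) * δ) ∈ B} ≤ volume B := by
  haveI : Countable ι := Finite.to_countable
  set W := Wall.balls (Torus.geometry d) ctr ρ hρ
  have hr0 : 0 ≤ 2 * V * δ := by positivity
  have hε' : ε < 2⁻¹ := by linarith
  have hρ' : ρ < 2⁻¹ := by linarith
  have hG := Torus.isHardSphereRegular_geometry (d := d) hε'
  have hGρ := Torus.isHardSphereRegular_geometry (d := d) hρ'
  induction m generalizing B with
  | zero =>
    have key := volume_cShortGood_inter_preimage_fwdFlow_le (N := N) (ctr := ctr) (hρ := hρ) hε hch hchρ le_rfl hV0 hδ hB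
    refine le_trans (measure_mono fun z hz => ?_) key
    simp only [Nat.cast_zero, zero_add, one_mul, mem_setOf_eq] at hz
    exact ⟨hz.1.2.1, hz.1.1, hz.2⟩
  | succ m ih =>
    set B' : Set (Config N d (UnitAddTorus d)) := {y | y ∈ cShortGood N ctr ε ρ (2 * V * δ) δ ∧
      configEnergy y ≤ V ^ 2 / 2 ∧ fwdFlow (Torus.geometry d) W ε y δ ∈ B} with hB'
    have hB'm : MeasurableSet B' :=
      (measurableSet_cShortGood ctr ε ρ _ δ).inter ((Alexander.measurableSet_energyShell _).inter
        (measurable_fwdFlow hG hGρ Torus.isMeasurable_geometry δ hB))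
    have hcast : (((m + 1 : ℕ) : ℝ) + 1) * δ = ((m : ℝ) + 1) * δ + δ := by push_cast; ring
    calc volume {z | z ∈ iterGood N ctr ρ (Wall.balls (Torus.geometry d) ctr ρ hρ) ε δ V (m + 1) ∧ fwdFlow (Torus.geometry d) W ε z ((((m + 1 : ℕ) : ℝ) + 1) * δ) ∈ B}
        ≤ volume {z | z ∈ iterGood N ctr ρ (Wall.balls (Torus.geometry d) ctr ρ hρ) ε δ V m ∧ fwdFlow (Torus.geometry d) W ε z (((m : ℝ) + 1) * δ) ∈ B'} := by
          refine measure_mono fun z hz => ⟨iterGood_succ_subset hρ m hz.1, ?_⟩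
          have hflow := fwdFlow_add_of_mem_iterGood hρ hε hch hchρ hV0 hδ m hz.1
          refine ⟨hz.1.2.2 m (Nat.lt_succ_self m), by rw [configEnergy_fwdFlow]; exact hz.1.1, ?_⟩
          have h2 := hz.2
          rw [hcast, hflow] at h2
          exact h2
      _ ≤ volume B' := ih hB'm
      _ ≤ volume B := volume_cShortGood_inter_preimage_fwdFlow_le hε hch hchρ le_rfl hV0 hδ hB

/-- The confined-short-time bad part of the energy shell has volume at most `windowLoss`
(separated scatterers). [folklore] -/
theorem volume_shell_diff_cShortGood_le (hε : 0 < ε) (hch : ε + 2 * (2 * V * δ) < 2⁻¹) (hchρ : ρ + 2 * (2 * V * δ) < 2⁻¹)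
    (hsep : ∀ k l : ι, k ≠ l → 2 * (ρ + 2 * V * δ) < Torus.euclidDist (ctr k) (ctr l)) (hV0 : 0 ≤ V) (hδ : 0 ≤ δ) :
    volume {z : Config N d (UnitAddTorus d) | z ∈ confinedDomain (Torus.geometry d) (Wall.balls (Torus.geometry d) ctr ρ hρ) N ε ∧
      configEnergy z ≤ V ^ 2 / 2 ∧ z ∉ cShortGood N ctr ε ρ (2 * V * δ) δ} ≤ windowLoss (d := d) N ι δ V := by
  classical
  haveI : Fintype ι := Fintype.ofFinite ι
  have hr0 : 0 ≤ 2 * V * δ := by positivity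
  have h12 : ε + 2 * V * δ < 1 / 2 := by
    have : (2⁻¹ : ℝ) = 1 / 2 := by norm_num
    linarith
  have h12ρ : ρ + 2 * V * δ < 1 / 2 := by
    have : (2⁻¹ : ℝ) = 1 / 2 := by norm_num
    linarith
  refine le_trans (measure_mono fun z hz => ?_)
    ((volume_diff_cShortGood_inter_velBall_le (hρ := hρ) hε hρ hr0 h12 h12ρ hsep δ V).trans (le_of_eq ?_))
  · exact ⟨⟨hz.1, hz.2.2⟩, setOf_configEnergy_le_subset_velBall hV0 hz.2.1⟩
  · rw [windowLoss, Nat.card_eq_fintype_card, Nat.card_eq_fintype_card]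

/-- **The volume lost in `m + 1` windows** is at most `(m + 1) · windowLoss`. [cite: GST2013, proof of Prop. 4.1.1 p. 19] -/
theorem volume_shell_diff_iterGood_le (hε : 0 < ε) (hch : ε + 2 * (2 * V * δ) < 2⁻¹) (hchρ : ρ + 2 * (2 * V * δ) < 2⁻¹)
    (hsep : ∀ k l : ι, k ≠ l → 2 * (ρ + 2 * V * δ) < Torus.euclidDist (ctr k) (ctr l)) (hV0 : 0 ≤ V) (hδ : 0 ≤ δ) (m : ℕ) :
    volume ({z : Config N d (UnitAddTorus d) | z ∈ confinedDomain (Torus.geometry d) (Wall.balls (Torus.geometry d) ctr ρ hρ) N ε ∧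
      configEnergy z ≤ V ^ 2 / 2} \ iterGood N ctr ρ (Wall.balls (Torus.geometry d) ctr ρ hρ) ε δ V m) ≤ (m + 1) * windowLoss (d := d) N ι δ V := by
  haveI : Countable ι := Finite.to_countable
  set W := Wall.balls (Torus.geometry d) ctr ρ hρ
  induction m with
  | zero =>
    rw [Nat.cast_zero, zero_add, one_mul]
    refine le_trans (measure_mono fun z hz => ?_) (volume_shell_diff_cShortGood_le hρ hε hch hchρ hsep hV0 hδ)
    refine ⟨hz.1.1, hz.1.2, fun hsg => hz.2 ⟨hz.1.2, hsg, fun k hk => (Nat.not_lt_zero k hk).elim⟩⟩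
  | succ m ih =>
    have hloss : volume (iterGood (d := d) N ctr ρ (Wall.balls (Torus.geometry d) ctr ρ hρ) ε δ V m \ iterGood N ctr ρ (Wall.balls (Torus.geometry d) ctr ρ hρ) ε δ V (m + 1)) ≤ windowLoss (d := d) N ι δ V := by
      refine le_trans ?_ (volume_shell_diff_cShortGood_le hρ hε hch hchρ hsep hV0 hδ)
      have hBm : MeasurableSet {z : Config N d (UnitAddTorus d) | z ∈ confinedDomain (Torus.geometry d) W N ε ∧
          configEnergy z ≤ V ^ 2 / 2 ∧ z ∉ cShortGood N ctr ε ρ (2 * V * δ) δ} :=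
        (measurableSet_confinedDomain_balls (ctr := ctr) (hρ := hρ) Torus.isMeasurable_geometry).inter
          ((Alexander.measurableSet_energyShell _).inter (measurableSet_cShortGood ctr ε ρ _ δ).compl)
      have key := volume_iterGood_inter_preimage_le (N := N) (ctr := ctr) hρ hε hch hchρ hV0 hδ m hBm
      refine le_trans (measure_mono fun z hz => ?_) key
      obtain ⟨hzm, hzn⟩ := hz
      have hreg := fwdGoodUpTo_of_mem_iterGood hρ hε hch hchρ hV0 hδ m hzm
      have hm0 : 0 ≤ ((m : ℝ) + 1) * δ := by positivity
      refine ⟨hzm, hreg.fwdFlow_mem hm0 le_rfl, by rw [configEnergy_fwdFlow]; exact hzm.1, fun hsg => hzn ?_⟩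
      exact ⟨hzm.1, hzm.2.1, fun k hk => by
        rcases Nat.lt_succ_iff_lt_or_eq.1 hk with hk | rfl
        · exact hzm.2.2 k hk
        · exact hsg⟩
    calc volume ({z : Config N d (UnitAddTorus d) | z ∈ confinedDomain (Torus.geometry d) W N ε ∧
            configEnergy z ≤ V ^ 2 / 2} \ iterGood N ctr ρ (Wall.balls (Torus.geometry d) ctr ρ hρ) ε δ V (m + 1))
        ≤ volume (({z : Config N d (UnitAddTorus d) | z ∈ confinedDomain (Torus.geometry d) W N ε ∧
            configEnergy z ≤ V ^ 2 / 2} \ iterGood N ctr ρ (Wall.balls (Torus.geometry d) ctr ρ hρ) ε δ V m) ∪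
              (iterGood N ctr ρ (Wall.balls (Torus.geometry d) ctr ρ hρ) ε δ V m \ iterGood N ctr ρ (Wall.balls (Torus.geometry d) ctr ρ hρ) ε δ V (m + 1))) := by
          refine measure_mono fun z hz => ?_
          by_cases hzm : z ∈ iterGood N ctr ρ (Wall.balls (Torus.geometry d) ctr ρ hρ) ε δ V m
          · exact Or.inr ⟨hzm, hz.2⟩
          · exact Or.inl ⟨hz.1, hzm⟩
      _ ≤ (m + 1) * windowLoss (d := d) N ι δ V + windowLoss (d := d) N ι δ V :=
          (measure_union_le _ _).trans (add_le_add ih hloss)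
      _ = ((m + 1 : ℕ) + 1) * windowLoss (d := d) N ι δ V := by push_cast; ring

omit [Finite ι] in
/-- The window loss as a multiple of `δ²`. [folklore] -/
theorem windowLoss_eq (hV0 : 0 ≤ V) (δ : ℝ) : windowLoss (d := d) N ι δ V = windowConst (d := d) N ι V * ENNReal.ofReal δ ^ 2 := by
  rw [windowLoss, windowConst]
  have : ENNReal.ofReal (Fintype.card d * (2 * V * δ)) = ENNReal.ofReal (Fintype.card d * (2 * V)) * ENNReal.ofReal δ := by
    rw [← ENNReal.ofReal_mul (by positivity)]; ring_nf
  rw [this]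
  ring

omit [Finite ι] in
/-- The constant `K(V)` is finite. [folklore] -/
theorem windowConst_lt_top (V : ℝ) : windowConst (d := d) N ι V < ∞ := by
  have h1 : volume (Metric.ball (0 : EuclideanSpace ℝ d) 1) < ∞ := measure_ball_lt_top
  have h2 : volume (Metric.closedBall (0 : EuclideanSpace ℝ d) V) < ∞ := measure_closedBall_lt_top
  refine ENNReal.mul_lt_top ?_ ?_
  · exact ENNReal.add_lt_top.2 ⟨ENNReal.pow_lt_top (ENNReal.natCast_lt_top N),
      ENNReal.add_lt_top.2 ⟨ENNReal.natCast_lt_top _, ENNReal.natCast_lt_top _⟩⟩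
  · refine ENNReal.mul_lt_top (ENNReal.pow_lt_top (ENNReal.mul_lt_top ENNReal.ofReal_lt_top h1)) ?_
    exact ENNReal.pow_lt_top h2

omit [Finite ι] in
/-- **The loss over a fixed horizon vanishes as the window shrinks.** [folklore] -/
theorem tendsto_windowLoss (hV0 : 0 ≤ V) {t : ℝ} (ht : 0 ≤ t) :
    Tendsto (fun m : ℕ => ((m : ℝ≥0∞) + 1) * windowLoss (d := d) N ι (t / ((m : ℝ) + 1)) V) atTop (𝓝 0) := by
  set K : ℝ≥0∞ := windowConst (d := d) N ι V with hK
  have hKtop : K ≠ ∞ := (windowConst_lt_top (d := d) (N := N) (ι := ι) V).ne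
  have heq : ∀ m : ℕ, ((m : ℝ≥0∞) + 1) * windowLoss (d := d) N ι (t / ((m : ℝ) + 1)) V =
      K * ENNReal.ofReal (t ^ 2 / ((m : ℝ) + 1)) := by
    intro m
    have hm : (0 : ℝ) < (m : ℝ) + 1 := by positivity
    rw [windowLoss_eq hV0, ← hK]
    have h1 : ((m : ℝ≥0∞) + 1) = ENNReal.ofReal ((m : ℝ) + 1) := by
      rw [ENNReal.ofReal_add (by positivity) zero_le_one, ENNReal.ofReal_natCast, ENNReal.ofReal_one]
    rw [h1, mul_comm (ENNReal.ofReal _) (K * _), mul_assoc, ← ENNReal.ofReal_pow (div_nonneg ht hm.le),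
      ← ENNReal.ofReal_mul (by positivity)]
    congr 2
    field_simp
  simp_rw [heq]
  have hreal : Tendsto (fun m : ℕ => t ^ 2 / ((m : ℝ) + 1)) atTop (𝓝 0) := by
    have h := tendsto_const_div_atTop_nhds_zero_nat (t ^ 2)
    have h' : Tendsto (fun m : ℕ => t ^ 2 / ((m + 1 : ℕ) : ℝ)) atTop (𝓝 0) := h.comp (tendsto_add_atTop_nat 1)
    simpa using h'
  have h2 : Tendsto (fun m : ℕ => ENNReal.ofReal (t ^ 2 / ((m : ℝ) + 1))) atTop (𝓝 0) := by
    simpa using ENNReal.tendsto_ofReal hreal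
  simpa using ENNReal.Tendsto.const_mul h2 (Or.inr hKtop)

/-- Eventually in `m`, the window `δ = t/(m+1)` satisfies the two chart conditions and the
separation condition of the scatterers. [folklore] -/
theorem eventually_charts {ε : ℝ} (hε' : ε < 2⁻¹) (hρ' : ρ < 2⁻¹)
    (hsep : ∀ k l : ι, k ≠ l → 2 * ρ < Torus.euclidDist (ctr k) (ctr l)) (V t : ℝ) :
    ∀ᶠ m : ℕ in atTop, ε + 2 * (2 * V * (t / ((m : ℝ) + 1))) < 2⁻¹ ∧ ρ + 2 * (2 * V * (t / ((m : ℝ) + 1))) < 2⁻¹ ∧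
      ∀ k l : ι, k ≠ l → 2 * (ρ + 2 * V * (t / ((m : ℝ) + 1))) < Torus.euclidDist (ctr k) (ctr l) := by
  have h : Tendsto (fun m : ℕ => 4 * V * t / ((m : ℝ) + 1)) atTop (𝓝 0) := by
    have h := tendsto_const_div_atTop_nhds_zero_nat (4 * V * t)
    have h' : Tendsto (fun m : ℕ => 4 * V * t / ((m + 1 : ℕ) : ℝ)) atTop (𝓝 0) := h.comp (tendsto_add_atTop_nat 1)
    simpa using h'
  have hid : ∀ m : ℕ, 2 * (2 * V * (t / ((m : ℝ) + 1))) = 4 * V * t / ((m : ℝ) + 1) := fun m => by ring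
  have hpos : (0 : ℝ) < 2⁻¹ - ε := by linarith
  have hposρ : (0 : ℝ) < 2⁻¹ - ρ := by linarith
  haveI : Finite (ι × ι) := inferInstance
  have hpair : ∀ p : ι × ι, ∀ᶠ m : ℕ in atTop, p.1 ≠ p.2 →
      2 * (ρ + 2 * V * (t / ((m : ℝ) + 1))) < Torus.euclidDist (ctr p.1) (ctr p.2) := by
    rintro ⟨k, l⟩
    by_cases hkl : k = l
    · exact Eventually.of_forall fun m h => (h hkl).elim
    · have hgap : (0 : ℝ) < Torus.euclidDist (ctr k) (ctr l) - 2 * ρ := by linarith [hsep k l hkl]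
      filter_upwards [Filter.Tendsto.eventually_lt_const hgap h] with m hm _
      have := hid m
      linarith
  filter_upwards [Filter.Tendsto.eventually_lt_const hpos h, Filter.Tendsto.eventually_lt_const hposρ h,
    eventually_all.2 hpair] with m hm hmρ hms
  refine ⟨by rw [hid m]; linarith, by rw [hid m]; linarith, fun k l hkl => hms (k, l) hkl⟩

/-! ## The bad set is null -/

/-- **Data of an energy shell that are not forward regular up to a fixed horizon are null.** [cite: GST2013, Prop. 4.1.1 p. 19] -/
theorem volume_not_fwdGoodUpTo_eq_zero {ε : ℝ} (hε : 0 < ε) (hε' : ε < 2⁻¹) (hρ' : ρ < 2⁻¹)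
    (hsep : ∀ k l : ι, k ≠ l → 2 * ρ < Torus.euclidDist (ctr k) (ctr l)) (hV0 : 0 ≤ V) {t : ℝ} (ht : 0 < t) :
    volume {z : Config N d (UnitAddTorus d) | z ∈ confinedDomain (Torus.geometry d) (Wall.balls (Torus.geometry d) ctr ρ hρ) N ε ∧
      configEnergy z ≤ V ^ 2 / 2 ∧ ¬ FwdGoodUpTo (Torus.geometry d) (Wall.balls (Torus.geometry d) ctr ρ hρ) ε t z} = 0 := by
  refine le_antisymm ?_ bot_le
  refine ge_of_tendsto (tendsto_windowLoss (d := d) (N := N) (ι := ι) hV0 ht.le) ?_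
  filter_upwards [eventually_charts hε' hρ' hsep V t] with m hm
  have hδ : 0 ≤ t / ((m : ℝ) + 1) := by positivity
  have hT : ((m : ℝ) + 1) * (t / ((m : ℝ) + 1)) = t := by field_simp
  refine le_trans (measure_mono fun z hz => ?_) (volume_shell_diff_iterGood_le hρ hε hm.1 hm.2.1 hm.2.2 hV0 hδ m)
  refine ⟨⟨hz.1, hz.2.1⟩, fun hzm => hz.2.2 ?_⟩
  have h := fwdGoodUpTo_of_mem_iterGood hρ hε hm.1 hm.2.1 hV0 hδ m hzm
  rwa [hT] at h

/-- **Forward regularity holds almost everywhere on the confined domain.** [cite: GST2013, Prop. 4.1.1 p. 19] -/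
theorem volume_not_fwdGood_eq_zero {ε : ℝ} (hε : 0 < ε) (hε' : ε < 2⁻¹) (hρ' : ρ < 2⁻¹)
    (hsep : ∀ k l : ι, k ≠ l → 2 * ρ < Torus.euclidDist (ctr k) (ctr l)) :
    volume {z : Config N d (UnitAddTorus d) | z ∈ confinedDomain (Torus.geometry d) (Wall.balls (Torus.geometry d) ctr ρ hρ) N ε ∧
      ¬ FwdGood (Torus.geometry d) (Wall.balls (Torus.geometry d) ctr ρ hρ) ε z} = 0 := by
  set W := Wall.balls (Torus.geometry d) ctr ρ hρ
  have hcov : {z : Config N d (UnitAddTorus d) | z ∈ confinedDomain (Torus.geometry d) W N ε ∧ ¬ FwdGood (Torus.geometry d) W ε z} ⊆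
      ⋃ T : ℕ, ⋃ V : ℕ, {z | z ∈ confinedDomain (Torus.geometry d) W N ε ∧ configEnergy z ≤ (V : ℝ) ^ 2 / 2 ∧
        ¬ FwdGoodUpTo (Torus.geometry d) W ε ((T : ℝ) + 1) z} := by
    rintro z ⟨hzD, hbad⟩
    rw [fwdGood_iff_forall_fwdGoodUpTo] at hbad
    push Not at hbad
    obtain ⟨T, hT⟩ := hbad
    obtain ⟨V, hV⟩ := exists_nat_ge (max 1 (2 * configEnergy z))
    refine mem_iUnion.2 ⟨T, mem_iUnion.2 ⟨V, hzD, ?_, fun h => hT (h.mono (by linarith))⟩⟩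
    have hV1 : (1 : ℝ) ≤ V := le_trans (le_max_left _ _) hV
    have hV2 : 2 * configEnergy z ≤ V := le_trans (le_max_right _ _) hV
    nlinarith
  refine measure_mono_null hcov (measure_iUnion_null fun T => measure_iUnion_null fun V => ?_)
  exact volume_not_fwdGoodUpTo_eq_zero hρ hε hε' hρ' hsep (Nat.cast_nonneg V) (by positivity)

/-- **The bad set of the confined dynamics is null** (CIP 1994 Thm. 4.2.1 (1)–(3) with App. 4.A
p. 111; Alexander 1975): for `0 < ε < 1/2`, `0 < ρ < 1/2` and separated round scatterers on the
flat torus, the complement of the good set `Γ₀` in the confined domain is Lebesgue-null. The bad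
data are: a pair in contact or a sphere on a scatterer (null), not forward regular (null,
`volume_not_fwdGood_eq_zero`), velocity flip not forward regular (null by
`measurePreserving_flipVel`). [cite: CIP1994, Thm. 4.2.1 and App. 4.A p. 111] -/
theorem volume_confinedDomain_diff_good_eq_zero {ε : ℝ} (hε : 0 < ε) (hε' : ε < 2⁻¹) (hρ' : ρ < 2⁻¹)
    (hsep : ∀ k l : ι, k ≠ l → 2 * ρ < Torus.euclidDist (ctr k) (ctr l)) :
    volume (confinedDomain (Torus.geometry d) (Wall.balls (Torus.geometry d) ctr ρ hρ) N ε \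
      good (Torus.geometry d) (Wall.balls (Torus.geometry d) ctr ρ hρ) ε) = 0 := by
  haveI : Countable ι := Finite.to_countable
  set W := Wall.balls (Torus.geometry d) ctr ρ hρ
  have hG := Torus.isHardSphereRegular_geometry (d := d) hε'
  have hGρ := Torus.isHardSphereRegular_geometry (d := d) hρ'
  have hGm : (Torus.geometry d).IsMeasurable := Torus.isMeasurable_geometry
  have hD : MeasurableSet (confinedDomain (Torus.geometry d) W N ε) := measurableSet_confinedDomain_balls hGm
  set Sf : Set (Config N d (UnitAddTorus d)) := {z | z ∈ confinedDomain (Torus.geometry d) W N ε ∧ ¬ FwdGood (Torus.geometry d) W ε z}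
    with hSf
  have hSfm : MeasurableSet Sf := hD.inter (measurableSet_fwdGood hG hGρ hGm).compl
  have hSf0 : volume Sf = 0 := volume_not_fwdGood_eq_zero hρ hε hε' hρ' hsep
  have hflip0 : volume (flipVel ⁻¹' Sf) = 0 := by
    rw [(measurePreserving_flipVel (X := UnitAddTorus d) (N := N) (d := d)).measure_preimage hSfm.nullMeasurableSet]
    exact hSf0
  have hcontact0 : volume (⋃ p : Fin N × Fin N, {z : Config N d (UnitAddTorus d) | p.1 ≠ p.2 ∧
      z ∈ contactSet (Torus.geometry d) N ε p.1 p.2}) = 0 := by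
    refine measure_iUnion_null fun p => ?_
    by_cases hp : p.1 = p.2
    · convert measure_empty (μ := (volume : Measure (Config N d (UnitAddTorus d))))
      ext z; simp [hp]
    · have : {z : Config N d (UnitAddTorus d) | p.1 ≠ p.2 ∧ z ∈ contactSet (Torus.geometry d) N ε p.1 p.2} =
          contactSet (Torus.geometry d) N ε p.1 p.2 := by
        ext z; simp [hp]
      rw [this]
      exact volume_contactSet hε.ne' hp
  have hwall0 : volume (⋃ q : Fin N × ι, {z : Config N d (UnitAddTorus d) | (z q.1).1 ∈ (W q.2).contact}) = 0 := by
    refine measure_iUnion_null fun q => ?_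
    exact volume_setOf_norm_sepVec_point_eq hρ.ne' q.1 (ctr q.2)
  have hcov : confinedDomain (Torus.geometry d) W N ε \ good (Torus.geometry d) W ε ⊆
      ((⋃ p : Fin N × Fin N, {z : Config N d (UnitAddTorus d) | p.1 ≠ p.2 ∧ z ∈ contactSet (Torus.geometry d) N ε p.1 p.2}) ∪
        (⋃ q : Fin N × ι, {z : Config N d (UnitAddTorus d) | (z q.1).1 ∈ (W q.2).contact})) ∪ Sf ∪ flipVel ⁻¹' Sf := by
    rintro z ⟨hzD, hzg⟩
    simp only [good, mem_setOf_eq, not_and] at hzg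
    by_cases hc : ∃ i j : Fin N, i ≠ j ∧ z ∈ contactSet (Torus.geometry d) N ε i j
    · obtain ⟨i, j, hij, hcz⟩ := hc
      exact Or.inl (Or.inl (Or.inl (mem_iUnion.2 ⟨(i, j), hij, hcz⟩)))
    push Not at hc
    by_cases hw : ∃ (i : Fin N) (k : ι), (z i).1 ∈ (W k).contact
    · obtain ⟨i, k, hik⟩ := hw
      exact Or.inl (Or.inl (Or.inr (mem_iUnion.2 ⟨(i, k), hik⟩)))
    push Not at hw
    by_cases hf : FwdGood (Torus.geometry d) W ε z
    · have hb : ¬ FwdGood (Torus.geometry d) W ε (flipVel z) :=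
        hzg hzD (fun i j hij hcz => absurd hcz (hc i j hij)) (fun i k hik => absurd hik (hw i k)) hf
      exact Or.inr ⟨flipVel_mem_confinedDomain_iff.2 hzD, hb⟩
    · exact Or.inl (Or.inr ⟨hzD, hf⟩)
  refine measure_mono_null hcov ?_
  exact measure_union_null (measure_union_null (measure_union_null hcontact0 hwall0) hSf0) hflip0

end Iteration

/-! ## Liouville's theorem -/

section Liouville

variable {ε : ℝ}

/-- **Sub-invariance on energy shells**: for `t ≥ 0` and measurable `B`,
`vol {z ∈ Γ₀ ∩ {E ≤ V²/2} | Φ_t z ∈ B} ≤ vol B`. [cite: GST2013, proof of Prop. 4.1.1 p. 19] -/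
theorem volume_good_shell_inter_preimage_le (hε : 0 < ε) (hε' : ε < 2⁻¹) (hρ' : ρ < 2⁻¹)
    (hsep : ∀ k l : ι, k ≠ l → 2 * ρ < Torus.euclidDist (ctr k) (ctr l)) {V : ℝ} (hV0 : 0 ≤ V)
    {t : ℝ} (ht : 0 ≤ t) {B : Set (Config N d (UnitAddTorus d))} (hB : MeasurableSet B) :
    volume {z : Config N d (UnitAddTorus d) | z ∈ good (Torus.geometry d) (Wall.balls (Torus.geometry d) ctr ρ hρ) ε ∧
      configEnergy z ≤ V ^ 2 / 2 ∧ fwdFlow (Torus.geometry d) (Wall.balls (Torus.geometry d) ctr ρ hρ) ε z t ∈ B} ≤ volume B := by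
  set W := Wall.balls (Torus.geometry d) ctr ρ hρ
  have hG := Torus.isHardSphereRegular_geometry (d := d) hε'
  have hGρ := Torus.isHardSphereRegular_geometry (d := d) hρ'
  rcases ht.eq_or_lt with h0 | htpos
  · refine measure_mono fun z hz => ?_
    have h : fwdFlow (Torus.geometry d) W ε z 0 = z := fwdFlow_zero_of_pos (exitTime_pos_of_mem_good hG hGρ hz.1)
    have h2 := hz.2.2
    rwa [← h0, h] at h2
  · have hlim : Tendsto (fun m : ℕ => volume B + ((m : ℝ≥0∞) + 1) * windowLoss (d := d) N ι (t / ((m : ℝ) + 1)) V) atTop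
        (𝓝 (volume B)) := by
      have h := (tendsto_const_nhds : Tendsto (fun _ : ℕ => volume B) atTop (𝓝 (volume B))).add
        (tendsto_windowLoss (d := d) (N := N) (ι := ι) hV0 ht)
      rwa [add_zero] at h
    refine ge_of_tendsto hlim ?_
    filter_upwards [eventually_charts hε' hρ' hsep V t] with m hm
    have hδ : 0 ≤ t / ((m : ℝ) + 1) := by positivity
    have hT : ((m : ℝ) + 1) * (t / ((m : ℝ) + 1)) = t := by field_simp
    calc volume {z : Config N d (UnitAddTorus d) | z ∈ good (Torus.geometry d) W ε ∧
          configEnergy z ≤ V ^ 2 / 2 ∧ fwdFlow (Torus.geometry d) W ε z t ∈ B}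
        ≤ volume ({z | z ∈ iterGood N ctr ρ (Wall.balls (Torus.geometry d) ctr ρ hρ) ε (t / ((m : ℝ) + 1)) V m ∧
            fwdFlow (Torus.geometry d) W ε z (((m : ℝ) + 1) * (t / ((m : ℝ) + 1))) ∈ B} ∪
            ({z : Config N d (UnitAddTorus d) | z ∈ confinedDomain (Torus.geometry d) W N ε ∧
              configEnergy z ≤ V ^ 2 / 2} \ iterGood N ctr ρ (Wall.balls (Torus.geometry d) ctr ρ hρ) ε (t / ((m : ℝ) + 1)) V m)) := by
          refine measure_mono fun z hz => ?_
          by_cases hzm : z ∈ iterGood N ctr ρ (Wall.balls (Torus.geometry d) ctr ρ hρ) ε (t / ((m : ℝ) + 1)) V m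
          · exact Or.inl ⟨hzm, by rw [hT]; exact hz.2.2⟩
          · exact Or.inr ⟨⟨good_subset_confinedDomain hz.1, hz.2.1⟩, hzm⟩
      _ ≤ volume B + ((m : ℝ≥0∞) + 1) * windowLoss (d := d) N ι (t / ((m : ℝ) + 1)) V :=
          (measure_union_le _ _).trans (add_le_add
            (volume_iterGood_inter_preimage_le hρ hε hm.1 hm.2.1 hV0 hδ m hB)
            (volume_shell_diff_iterGood_le hρ hε hm.1 hm.2.1 hm.2.2 hV0 hδ m))

/-- **Invariance on energy shells** (`t ≥ 0`): `vol(S_V ∩ Φ_t⁻¹ B) = vol(S_V ∩ B)` for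
`S_V = Γ₀ ∩ {E ≤ V²/2}`. [cite: CIP1994, App. 4.A pp. 107–111] -/
theorem volume_good_shell_inter_preimage_eq (hε : 0 < ε) (hε' : ε < 2⁻¹) (hρ' : ρ < 2⁻¹)
    (hsep : ∀ k l : ι, k ≠ l → 2 * ρ < Torus.euclidDist (ctr k) (ctr l)) {V : ℝ} (hV0 : 0 ≤ V)
    {t : ℝ} (ht : 0 ≤ t) {B : Set (Config N d (UnitAddTorus d))} (hB : MeasurableSet B) :
    volume ({z : Config N d (UnitAddTorus d) | z ∈ good (Torus.geometry d) (Wall.balls (Torus.geometry d) ctr ρ hρ) ε ∧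
        configEnergy z ≤ V ^ 2 / 2} ∩ (fun z => fwdFlow (Torus.geometry d) (Wall.balls (Torus.geometry d) ctr ρ hρ) ε z t) ⁻¹' B) =
      volume ({z : Config N d (UnitAddTorus d) | z ∈ good (Torus.geometry d) (Wall.balls (Torus.geometry d) ctr ρ hρ) ε ∧
        configEnergy z ≤ V ^ 2 / 2} ∩ B) := by
  haveI : Countable ι := Finite.to_countable
  set W := Wall.balls (Torus.geometry d) ctr ρ hρ
  have hG := Torus.isHardSphereRegular_geometry (d := d) hε'
  have hGρ := Torus.isHardSphereRegular_geometry (d := d) hρ'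
  have hGm : (Torus.geometry d).IsMeasurable := Torus.isMeasurable_geometry
  set S : Set (Config N d (UnitAddTorus d)) := {z | z ∈ good (Torus.geometry d) W ε ∧ configEnergy z ≤ V ^ 2 / 2} with hS
  set T : Config N d (UnitAddTorus d) → Config N d (UnitAddTorus d) := fun z => fwdFlow (Torus.geometry d) W ε z t with hT
  have hSm : MeasurableSet S := (measurableSet_good hG hGρ hGm).inter (Alexander.measurableSet_energyShell _)
  have hmaps : MapsTo T S S := by
    intro z hz
    refine ⟨?_, ?_⟩
    · have h := mapsTo_flow_good hG hGρ t hz.1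
      rwa [flow_of_nonneg ht] at h
    · show configEnergy (fwdFlow (Torus.geometry d) W ε z t) ≤ V ^ 2 / 2
      rw [configEnergy_fwdFlow]; exact hz.2
  have hfin : volume S ≠ ∞ := by
    have hsub : S ⊆ velBall N d (UnitAddTorus d) V := fun z hz => setOf_configEnergy_le_subset_velBall hV0 hz.2
    refine ((measure_mono hsub).trans_lt ?_).ne
    rw [volume_velBall]
    exact ENNReal.pow_lt_top measure_closedBall_lt_top
  have hle : ∀ C : Set (Config N d (UnitAddTorus d)), MeasurableSet C → volume (S ∩ T ⁻¹' C) ≤ volume C := by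
    intro C hC
    have h := volume_good_shell_inter_preimage_le hρ hε hε' hρ' hsep hV0 ht hC
    have hset : S ∩ T ⁻¹' C = {z : Config N d (UnitAddTorus d) | z ∈ good (Torus.geometry d) W ε ∧
        configEnergy z ≤ V ^ 2 / 2 ∧ fwdFlow (Torus.geometry d) W ε z t ∈ C} := by
      ext z; simp only [hS, hT, mem_inter_iff, mem_setOf_eq, mem_preimage, and_assoc]
    rw [hset]; exact h
  have h1 : volume (S ∩ T ⁻¹' (S ∩ B)) ≤ volume (S ∩ B) := hle _ (hSm.inter hB)
  have h2 : volume (S ∩ T ⁻¹' (S \ B)) ≤ volume (S \ B) := hle _ (hSm.diff hB)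
  have hsum : volume (S ∩ T ⁻¹' (S ∩ B)) + volume (S ∩ T ⁻¹' (S \ B)) = volume S := by
    have hTm : Measurable T := measurable_fwdFlow hG hGρ hGm t
    have e1 : S ∩ T ⁻¹' (S ∩ B) = S ∩ T ⁻¹' S ∩ T ⁻¹' B := by
      ext z; simp only [mem_inter_iff, mem_preimage]; tauto
    have e2 : S ∩ T ⁻¹' (S \ B) = (S ∩ T ⁻¹' S) \ T ⁻¹' B := by
      ext z; simp only [mem_inter_iff, mem_preimage, Set.mem_sdiff]; tauto
    have e3 : S ∩ T ⁻¹' S = S := by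
      ext z; simp only [mem_inter_iff, mem_preimage, and_iff_left_iff_imp]; exact fun hz => hmaps hz
    rw [e1, e2, measure_inter_add_sdiff _ (hTm hB), e3]
  have hsum' : volume (S ∩ B) + volume (S \ B) = volume S := measure_inter_add_sdiff S hB
  have heq : volume (S ∩ T ⁻¹' (S ∩ B)) = volume (S ∩ B) :=
    Alexander.ennreal_eq_of_add_eq_add_of_le h1 h2 (hsum.trans hsum'.symm) (by rw [hsum']; exact hfin)
  have hset : S ∩ T ⁻¹' B = S ∩ T ⁻¹' (S ∩ B) := by
    ext z
    simp only [mem_inter_iff, mem_preimage]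
    exact ⟨fun h => ⟨h.1, hmaps h.1, h.2⟩, fun h => ⟨h.1, h.2.2⟩⟩
  rw [hset, heq]

/-- **Invariance of `vol|_{Γ₀}` under `Φ_t`, `t ≥ 0`** (exhaustion by energy shells). [cite: CIP1994, App. 4.A pp. 107–111] -/
theorem volume_good_inter_preimage_fwdFlow_eq (hε : 0 < ε) (hε' : ε < 2⁻¹) (hρ' : ρ < 2⁻¹)
    (hsep : ∀ k l : ι, k ≠ l → 2 * ρ < Torus.euclidDist (ctr k) (ctr l)) {t : ℝ} (ht : 0 ≤ t)
    {B : Set (Config N d (UnitAddTorus d))} (hB : MeasurableSet B) :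
    volume (good (Torus.geometry d) (Wall.balls (Torus.geometry d) ctr ρ hρ) ε ∩
        (fun z => fwdFlow (Torus.geometry d) (Wall.balls (Torus.geometry d) ctr ρ hρ) ε z t) ⁻¹' B) =
      volume (good (N := N) (Torus.geometry d) (Wall.balls (Torus.geometry d) ctr ρ hρ) ε ∩ B) := by
  set W := Wall.balls (Torus.geometry d) ctr ρ hρ
  have hS : ∀ X : Set (Config N d (UnitAddTorus d)), good (Torus.geometry d) W ε ∩ X =
      ⋃ V : ℕ, ({z : Config N d (UnitAddTorus d) | z ∈ good (Torus.geometry d) W ε ∧ configEnergy z ≤ (V : ℝ) ^ 2 / 2} ∩ X) := by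
    intro X
    ext z
    simp only [mem_inter_iff, mem_iUnion, mem_setOf_eq]
    constructor
    · rintro ⟨hg, hx⟩
      obtain ⟨V, hV⟩ := exists_nat_ge (max 1 (2 * configEnergy z))
      have hV1 : (1 : ℝ) ≤ V := le_trans (le_max_left _ _) hV
      have hV2 : 2 * configEnergy z ≤ V := le_trans (le_max_right _ _) hV
      exact ⟨V, ⟨hg, by nlinarith⟩, hx⟩
    · rintro ⟨V, ⟨hg, -⟩, hx⟩
      exact ⟨hg, hx⟩
  have hmono : ∀ X : Set (Config N d (UnitAddTorus d)), Monotone fun V : ℕ =>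
      ({z : Config N d (UnitAddTorus d) | z ∈ good (Torus.geometry d) W ε ∧ configEnergy z ≤ (V : ℝ) ^ 2 / 2} ∩ X) := by
    intro X a b hab z hz
    refine ⟨⟨hz.1.1, hz.1.2.trans ?_⟩, hz.2⟩
    have : (a : ℝ) ≤ b := Nat.cast_le.2 hab
    have ha : (0 : ℝ) ≤ a := Nat.cast_nonneg a
    nlinarith
  rw [hS, hS B, (hmono _).measure_iUnion, (hmono _).measure_iUnion]
  exact iSup_congr fun V => volume_good_shell_inter_preimage_eq hρ hε hε' hρ' hsep (Nat.cast_nonneg V) ht hB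

/-- **Invariance of `vol|_{Γ₀}` under `T^t` for all `t`** (for `t < 0`, `T^t` inverts `T^{-t}` on `Γ₀`). [cite: CIP1994, §4.2 (2.3)] -/
theorem volume_good_inter_preimage_flow_eq (hε : 0 < ε) (hε' : ε < 2⁻¹) (hρ' : ρ < 2⁻¹)
    (hsep : ∀ k l : ι, k ≠ l → 2 * ρ < Torus.euclidDist (ctr k) (ctr l)) (t : ℝ)
    {B : Set (Config N d (UnitAddTorus d))} (hB : MeasurableSet B) :
    volume (good (Torus.geometry d) (Wall.balls (Torus.geometry d) ctr ρ hρ) ε ∩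
        flow (Torus.geometry d) (Wall.balls (Torus.geometry d) ctr ρ hρ) ε t ⁻¹' B) =
      volume (good (N := N) (Torus.geometry d) (Wall.balls (Torus.geometry d) ctr ρ hρ) ε ∩ B) := by
  haveI : Countable ι := Finite.to_countable
  set W := Wall.balls (Torus.geometry d) ctr ρ hρ
  have hG := Torus.isHardSphereRegular_geometry (d := d) hε'
  have hGρ := Torus.isHardSphereRegular_geometry (d := d) hρ'
  have hGm : (Torus.geometry d).IsMeasurable := Torus.isMeasurable_geometry
  rcases le_or_gt 0 t with ht | ht
  · have hset : good (Torus.geometry d) W ε ∩ flow (Torus.geometry d) W ε t ⁻¹' B =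
        good (N := N) (Torus.geometry d) W ε ∩ (fun z => fwdFlow (Torus.geometry d) W ε z t) ⁻¹' B := by
      ext z; simp only [mem_inter_iff, mem_preimage, flow_of_nonneg ht]
    rw [hset]
    exact volume_good_inter_preimage_fwdFlow_eq hρ hε hε' hρ' hsep ht hB
  · have hs : 0 ≤ -t := by linarith
    set A : Set (Config N d (UnitAddTorus d)) := good (Torus.geometry d) W ε ∩ flow (Torus.geometry d) W ε t ⁻¹' B with hA
    have hAm : MeasurableSet A := (measurableSet_good hG hGρ hGm).inter (measurable_flow hG hGρ hGm t hB)
    have key := volume_good_inter_preimage_fwdFlow_eq hρ hε hε' hρ' hsep hs hAm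
    have hinv : ∀ z ∈ good (N := N) (Torus.geometry d) W ε, flow (Torus.geometry d) W ε t (flow (Torus.geometry d) W ε (-t) z) = z := by
      intro z hz
      rw [← flow_add_of_mem_good hG hGρ t (-t) hz, add_neg_cancel, flow_zero_of_mem_good hG hGρ hz]
    have h1 : good (Torus.geometry d) W ε ∩ (fun z => fwdFlow (Torus.geometry d) W ε z (-t)) ⁻¹' A =
        good (Torus.geometry d) W ε ∩ B := by
      ext z
      simp only [hA, mem_inter_iff, mem_preimage, ← flow_of_nonneg hs]
      constructor
      · rintro ⟨hz, -, hzB⟩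
        rw [hinv z hz] at hzB
        exact ⟨hz, hzB⟩
      · rintro ⟨hz, hzB⟩
        refine ⟨hz, mapsTo_flow_good hG hGρ (-t) hz, ?_⟩
        rw [hinv z hz]
        exact hzB
    have h2 : good (Torus.geometry d) W ε ∩ A = A := inter_eq_right.2 inter_subset_left
    rw [h1, h2] at key
    exact key.symm

/-- **Liouville's theorem for the confined hard-sphere flow on the torus among round scatterers**:
each `T^t` preserves the confined Liouville measure `dZ|_{confinedDomain}` (CIP 1994 §4.2 p. 65
and App. 4.A; the bad set being null, `confinedLiouville = vol|_{Γ₀}`, which is invariant). [cite: CIP1994, App. 4.A pp. 107–111] -/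
theorem measurePreserving_flow (hε : 0 < ε) (hε' : ε < 2⁻¹) (hρ' : ρ < 2⁻¹)
    (hsep : ∀ k l : ι, k ≠ l → 2 * ρ < Torus.euclidDist (ctr k) (ctr l)) (t : ℝ) :
    MeasurePreserving (flow (N := N) (Torus.geometry d) (Wall.balls (Torus.geometry d) ctr ρ hρ) ε t)
      (confinedLiouville (Torus.geometry d) (Wall.balls (Torus.geometry d) ctr ρ hρ) N ε)
      (confinedLiouville (Torus.geometry d) (Wall.balls (Torus.geometry d) ctr ρ hρ) N ε) := by
  haveI : Countable ι := Finite.to_countable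
  set W := Wall.balls (Torus.geometry d) ctr ρ hρ
  have hG := Torus.isHardSphereRegular_geometry (d := d) hε'
  have hGρ := Torus.isHardSphereRegular_geometry (d := d) hρ'
  have hGm : (Torus.geometry d).IsMeasurable := Torus.isMeasurable_geometry
  have hgood : MeasurableSet (good (N := N) (Torus.geometry d) W ε) := measurableSet_good hG hGρ hGm
  have hae : confinedDomain (Torus.geometry d) W N ε =ᵐ[volume] good (Torus.geometry d) W ε := by
    rw [ae_eq_set]
    exact ⟨volume_confinedDomain_diff_good_eq_zero hρ hε hε' hρ' hsep,
      measure_mono_null (fun z hz => (hz.2 (good_subset_confinedDomain hz.1)).elim) measure_empty⟩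
  have hL : confinedLiouville (Torus.geometry d) W N ε = volume.restrict (good (Torus.geometry d) W ε) := by
    rw [confinedLiouville_eq]; exact Measure.restrict_congr_set hae
  refine ⟨measurable_flow hG hGρ hGm t, ?_⟩
  rw [hL]
  ext B hB
  rw [Measure.map_apply (measurable_flow hG hGρ hGm t) hB, Measure.restrict_apply (measurable_flow hG hGρ hGm t hB),
    Measure.restrict_apply hB, inter_comm, volume_good_inter_preimage_flow_eq hρ hε hε' hρ' hsep t hB, inter_comm]

/-- The confined Liouville measure of the complement of the good set vanishes. [cite: CIP1994, Thm. 4.2.1] -/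
theorem confinedLiouville_compl_good (hε : 0 < ε) (hε' : ε < 2⁻¹) (hρ' : ρ < 2⁻¹)
    (hsep : ∀ k l : ι, k ≠ l → 2 * ρ < Torus.euclidDist (ctr k) (ctr l)) :
    confinedLiouville (Torus.geometry d) (Wall.balls (Torus.geometry d) ctr ρ hρ) N ε
      (good (Torus.geometry d) (Wall.balls (Torus.geometry d) ctr ρ hρ) ε)ᶜ = 0 := by
  haveI : Countable ι := Finite.to_countable
  set W := Wall.balls (Torus.geometry d) ctr ρ hρ
  have hG := Torus.isHardSphereRegular_geometry (d := d) hε'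
  have hGρ := Torus.isHardSphereRegular_geometry (d := d) hρ'
  have hGm : (Torus.geometry d).IsMeasurable := Torus.isMeasurable_geometry
  rw [confinedLiouville_eq, Measure.restrict_apply (measurableSet_good hG hGρ hGm).compl]
  have hset : (good (Torus.geometry d) W ε)ᶜ ∩ confinedDomain (Torus.geometry d) W N ε =
      confinedDomain (Torus.geometry d) W N ε \ good (Torus.geometry d) W ε := by
    ext z; constructor <;> rintro ⟨h1, h2⟩ <;> exact ⟨h2, h1⟩
  rw [hset]
  exact volume_confinedDomain_diff_good_eq_zero hρ hε hε' hρ' hsep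

end Liouville

/-! ## The confined hard-sphere flow exists -/

/-- **The confined hard-sphere flow on the flat torus among separated round scatterers exists**:
for `0 < ε < 1/2`, `0 < ρ < 1/2`, finitely many centres with `2ρ < dist(c_k, c_l)` (`k ≠ l`) and
every `N`, the event-by-event flow `ConfinedAlexander.flow` with good set `ConfinedAlexander.good`
inhabits the hypothesis structure `ConfinedHardSphereFlow` (CIP 1994 Thm. 4.2.1 with App. 4.A
p. 111; Alexander 1975). [cite: CIP1994, Thm. 4.2.1 and App. 4.A p. 111] -/
theorem exists_confinedHardSphereFlow {ε : ℝ} (hε : 0 < ε) (hε' : ε < 2⁻¹) (hρ' : ρ < 2⁻¹)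
    (hsep : ∀ k l : ι, k ≠ l → 2 * ρ < Torus.euclidDist (ctr k) (ctr l)) (N : ℕ) :
    Nonempty (ConfinedHardSphereFlow (Torus.geometry d) (Wall.balls (Torus.geometry d) ctr ρ hρ) ε N) := by
  obtain ⟨hmaps, h0, hadd⟩ := flow_group_torus hε' hρ hρ' ctr N
  obtain ⟨hgm, hfm⟩ := flow_measurable_torus hε' hρ hρ' ctr N
  exact ⟨{ flow := flow (Torus.geometry d) (Wall.balls (Torus.geometry d) ctr ρ hρ) ε
           good := good (Torus.geometry d) (Wall.balls (Torus.geometry d) ctr ρ hρ) ε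
           measurableSet_good := hgm
           good_subset := good_subset_confinedDomain
           measure_compl_good := confinedLiouville_compl_good hρ hε hε' hρ' hsep
           mapsTo_good := hmaps
           flow_zero := h0
           flow_add := hadd
           measurable_flow := hfm
           isTrajectory := fun z hz => isConfinedHardSphereTrajectory_flow_torus hε' hρ hρ' ctr hz
           measurePreserving := measurePreserving_flow hρ hε hε' hρ' hsep }⟩

end ConfinedAlexander

end Kinetic

end

end Literature.Analysis.FluidPDE
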